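import Mathlib
import HarnessLib
import HarnessLib.Audit
import Summits.PneNP.Statement
import Literature.Computability.Complexity.CookBridges
import Literature.ModelTheory.FiniteModelTheory.ESOPrefixClasses
import Literature.ModelTheory.FiniteModelTheory.GeneralizedSpectraComplement
import Literature.ModelTheory.FiniteModelTheory.NonThreeColUniversalPrefix

/-!
Route: AeaCutRectangles

DORMANT since 2026-09-03T06:56:26Z (reconciler: no traction for 5 d (last activity item-evidence-added at 2026-08-29T06:08:58Z); parked, not closed — `ledger route dormant route-PneNP-AeaCutRectangles --off` to reactivate) — unstaffed, not closed; items shared with open routes are served there. `ledger route dormant <id> --off` reactivates.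

# Route AeaCutRectangles — a fooling measure on non-3-colourable graphs beats the cut-rectangle
cover of ESO(∃*∀∃∀); the Fagin brick above that rung is the declared residual

FRONTIER LADDER ROUTE on Fagin's complement axis (typed from mwave sketch PneNP/aea-cut-rectangles).
X = X1 ∧ R. X1 (FOOLING MEASURE,
the attacked rung, refuter-decidable in principle): for some ε ∈ (0,1/4] and every C, for infinitely
many n there is a probability measure
on the non-3-colourable loopless edge sets over [n] giving every CUT RECTANGLE 𝓐 ⊗ 𝓑 inside
NON-3-COL over every near-balanced vertex
set B mass ≤ 2^{−(n/2)·log₂ n − C·n}. By the cut-and-hybridise cover theorem (support S1,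
archive-proved) X1 gives the node
T = NON-3-COL ∉ ESO(∃*∀∃∀) — the first prefix class of existential second-order logic beyond monadic
NP with arbitrary-arity
relation variables (it contains HAM, CONN, EVEN and NP-complete problems). R (DECLARED RESIDUAL, not
claimed): T lifts to
NON-3-COL ∉ ESO = Fagin's 1974 complement problem for 3-colourability; the deciding theorem then
reaches P ≠ NP through the PROVED
Fagin-complement step (Literature `NP_ne_coNP_of_not_isESODefinable_nonThreeColClass`: 3-COL is
ESO-definable and NP = coNP closes
ESO-definable classes under complement, Fagin1993 Thms 5.2–5.3) and P = NP ⇒ NP = coNP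
(`co_P_holds`).
Lean: `Summit.PneNP.PneNP.Theses.AeaCutRectangles.FoolingMeasure ∧
Summit.PneNP.PneNP.Theses.AeaCutRectangles.AEARungLifts`

## Assembly
Deciding theorem `closes (h₁ : FoolingMeasure) (hS1 : CutRectangleReduction) (hR : AEARungLifts) :
PneNP` (glue.lean, 9 lines, sorry-free,
axioms propext/Classical.choice/Quot.sound): `pneNP_shape_of_P_ne_NP` reduces to refuting P = NP; P
= NP ⇒ NP = coNP (`co_P_holds`), while
`NP_ne_coNP_of_not_isESODefinable_nonThreeColClass (hR (hS1 h₁))`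
(Literature/ModelTheory/FiniteModelTheory/GeneralizedSpectraComplement,
Fagin1993 Thm 5.3 with 5.2: `isESODefinable_threeColClass` + `isESODefinable_compl_of_NP_eq_coNP`)
gives NP ≠ coNP. The Assembly item restates
`closes` (schema-required); cone = {FoolingMeasure, CutRectangleReduction, AEARungLifts,
NonThreeColNotInAEA} + kill path NoFoolingMeasure.

Rationale: WHY THIS LINE. Mechanism (archive 2001, generalized-spectra-complement/work/aea/AEA.md §3–4,
blind-checked): an ESO(∃^p∀∃∀) sentence in Skolem form
∀x∀z θ(x,f(x),z,c̄) reads only tuples supported on {x,f(x),z} ∪ C; a near-bisection B adapted to the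
functional digraph of f with
|L(B)|+|X(B)| = O(log 1/ε) boundary defects (cut lemma 3.7) makes two models with the same KEY (B,
c̄, f|B̃, boundary values) hybridise
(3.4), so the defined class 𝒞_n is covered by ≤ 2^{(n/2)log₂ n + c_{Φ,ε} n} cut rectangles inside 𝒞
(3.5/3.8); a measure on NON-3-COL_n
with no heavy cut rectangle (X1) therefore forbids any such sentence for NON-3-COL (4.2/4.4).
Imported areas: communication-complexity
fooling/rectangle arguments (KarchmerWigderson1990 paradigm) transplanted to Skolem-function cuts;
topological chromatic theory
(Lovász–Kneser, Matousek2002) for the intended spread defect systems (two-layer plan). What it does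
that prior PneNP routes do not:
Descriptive / ChoicelessCapture / SymmetryBudget are capture-of-P routes and NtimeComplementLadder
is the machine-time axis; no route,
card or negatives entry of this summit carries Fagin's complement problem or an ESO prefix-class
non-definability statement (searches in
§ Novelty). The Fagin-complement step is a Literature theorem used inside `closes`, so no binder
restates NP ≠ coNP; the attacked binder X1 is a
combinatorial statement NOT implied by NP ≠ coNP (the rectangle method is sufficient, not necessary:
AEA.md Rem 3.6), S1 is an archive THEOREM
to port, and only R (declared residual) is NP ≠ coNP-dominated. A sibling typing seat (sketch
PneNP/non3col-eso-cut-rectangles, route-to-be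
NonThreeColCutRectangles) types the SAME archive line with T as the binder; this route is the
alternative decomposition T ⇐ X1 (D-0019: separate
route sharing the decl T), whose binder X1 and kill path ¬X1 are refuter-decidable statements of
finite combinatorics.

RANKED CRUXES. #0 NonThreeColNotInAEA (target) — the node T: NON-3-COLOURABILITY ∉ ESO(∃*∀∃∀) — no
ESO sentence with relation variables of arbitrary arities, any number of leading first-order ∃
(constants) and first-order prefix ∀∃∀ over a quantifier-free matrix defines, over finite binary
tables ([n], E), the class whose loop-free symmetrised graph is not 3-colourable (typed over
Literature.ModelTheory.FiniteModelTheory.IsPrefixDefinable / nonThreeColClass, shared with the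
sibling typing of sketch non3col-eso-cut-rectangles). (why it might fail: ESO(∀∃∀) is strong — HAM,
CONN, EVEN (AEA.md §1) and NP-complete problems (E₁aea, GottlobKolaitisSchwentick2004 p.11) live in
it; a Skolem function cleverer than 'successor along a certificate' might certify
non-3-colourability with one ∀∃∀ block.) [Fagin1974, Ajtai1983, GottlobKolaitisSchwentick2004,
archive:2001/pnp/generalized-spectra-complement/work/aea/AEA.md §1 §7]
#2 FoolingMeasure (crux) — (★★) in near-bisection form (AEA.md Rem 4.4 + Cor 3.8; sketch X1): there
is ε ∈ (0,1/4] such that for every C, for infinitely many n, some probability measure μ on loopless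
non-3-colourable edge sets over [n] gives every cut rectangle inside NON-3-COL over every B with
(1/2−ε)n ≤ |B| ≤ (1/2+ε)n — 𝓐 a finite family of loopless edge sets each edge meeting [n]∖B, 𝓑 a
finite family of loopless edge sets inside B, every α ∪ β non-3-colourable — total mass
Σ_{(α,β)∈𝓐×𝓑} μ(α ∪ β) ≤ 2^{−(n/2)·log₂ n − C·n}. [difficulty: XL] (why it might fail: AEA.md §6:
every defect system found so far has a near-balanced cut with split value 0 (F-5.1's B_X),
spectral/SDP certificates (Rem 6.5) suggest μ-heavy rectangles for random-like supports, and the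
½·n·log₂n threshold equals the key count with no slack (Rem 3.6a).)
[archive:2001/pnp/generalized-spectra-complement/work/aea/AEA.md §4 Rem 4.4 §5 §6,
KarchmerWigderson1990, doi:10.1016/0097-3165(78)90022-5, Matousek2002, Toft1995HandbookColouring]
#3 AEARungLifts (crux) — DECLARED RESIDUAL (imported complement of the attacked rung, not claimed;
signature written with T inlined so that it is letter-identical to the sibling route's item
PrefixClimb, stmt-PneNP-19512, and the target T below is letter-identical to its NonThreeColNotAEA,
stmt-PneNP-19511 — the ledger shares both): the ∀∃∀ rung lifts to full ESO — if NON-3-COL ∉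
ESO(∃*∀∃∀) then NON-3-COL is not ESO-definable over binary tables at all (not a generalized
spectrum), i.e. Fagin's 1974 complement problem for 3-colourability given the rung. The deciding
theorem turns its conclusion into P ≠ NP by the proved Fagin-complement step. [deps:
NonThreeColNotInAEA] [difficulty: open-problem] (why it might fail: summit-hard in substance — its
conclusion yields NP ≠ coNP (Fagin + coNP-completeness of NON-3-COL); nothing is known to propagate
a ∀∃∀ non-definability up the ESO prefix hierarchy, and Rem 3.6(a) caps the cut-rectangle method
itself at this rung.) [Fagin1974, Fagin1993, AjtaiFagin1990, Immerman1999,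
book:libkinnd-elements-finite-model-theory p.187,
archive:2001/pnp/generalized-spectra-complement/work/aea/AEA.md Rem 3.6]
#9 CutRectangleReduction (support) — the cut-rectangle method (archive-proved, to be formalised):
FoolingMeasure → NonThreeColNotInAEA. Ingredients: Skolem normal form of ∃R̄∃c̄∀x∃y∀zθ;
near-bisection cut lemma 3.7 (for f : V → V and ε ≤ 1/4 a B with n/2−εn ≤ |B| ≤ n/2 and
|L(B)|+|X(B)| ≤ 4(⌈log₂(1/ε)⌉+1)); hybrid lemma 3.4 (equal keys ⇒ M₁ ▷_B M₂ ⊨ ψ, by locality of the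
quantifier-free matrix on {x,f x,z} ∪ C); rectangle cover 3.5/3.8 with ≤ 2^{(n/2)log₂ n + c_{Φ,ε} n}
keys; union bound against μ with C := c_{Φ,ε}+1. Restriction from all binary tables to symmetric
loop-free ones is harmless (a defining sentence restricts). [difficulty: L]
[archive:2001/pnp/generalized-spectra-complement/work/aea/AEA.md Lemma 3.4 Lemma 3.7 Thm 3.5 Cor 3.8
Thm 4.2 (records bc-aea-rectangles bc-aea-cut37), Immerman1999]
#9 NoFoolingMeasure (support) — kill path of X1 (filed so the negative side is visible): every
probability measure on NON-3-COL_n admits, for some near-balanced B, a cut rectangle inside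
NON-3-COL of mass > 2^{−(n/2)log₂ n − C n}; a proof retires the cut-rectangle method on
non-3-colourability (AEA.md §7, 'negative answer') and is banked as a barrier note. [difficulty: XL]
[archive:2001/pnp/generalized-spectra-complement/work/aea/AEA.md §6 Prop 6.1–Rem 6.5]

TWO-LAYER PLAN. Foreseen glued split of X1 once staffed (registered now only as X1's birth skeleton,
bc/FoolingMeasure_birth.lean): X1 ⇐ SpreadDefectSystems →
(AEA.md Thm 4.2, counting transversals) → X1, where SpreadDefectSystems = for every C, infinitely
many n carry a defect system (W; disjoint
units π_i, |π_i| ≥ 2; D1 every 3-colouring proper on W makes a unit monochromatic; D2 deleting any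
unit leaves a 3-colourable graph) whose
split value s(B) ≥ (n/2)log₂ n + C n on all near-bisections; and SpreadDefectSystems ⇐
DoubledKneserLovasz (DKL-1: the doubled Kneser
graph with (N−2k+3)-cliques joined is 4-chromatic with the twin pairs as minimal defect units, a
Z/2-Borsuk–Ulam statement; DKL-2: its
split value is spread). The F-5.1 fixed-cut system (4-critical K + diamonds, s(B₀) = e(K)) is the
first rung (bc5).

KILL CRITERIA. ¬FoolingMeasure proved (NoFoolingMeasure) ⇒ close `refuted:FoolingMeasure`: the
cut-rectangle method is dead on NON-3-COL and the witness
(a heavy-rectangle theorem for all measures) is banked under Barrier notes; no pivot inside this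
route (a different non-definability method
is a different route). NonThreeColNotInAEA refuted (an explicit ESO(∃^p∀∃∀) sentence for NON-3-COL)
⇒ the whole axis below R dies and
R becomes vacuous — close refuted. AEARungLifts is residual: its refutation (T true but NON-3-COL a
generalized spectrum) would mean
NP = coNP-flavoured news and closes the route as well. NP ≠ coNP proved elsewhere moots R but not
X1/T (they stay as frontier theorems).

NOT DECOMPOSED YET. The defect-system layer (SpreadDefectSystems, DoubledKneserLovasz, the F-5.1
fixed-cut rung) stays inside X1's registered skeleton, not
items; the formalisation lemmas of S1 (QF-realize congruence under finite-support agreement, the cut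
lemma's pool/round bookkeeping, key
counting) ride with provers via --supports; no definition items at open (IsPrefixDefinable,
nonThreeColClass, adjTable landed in
Literature.ModelTheory.FiniteModelTheory.ESOPrefixClasses, p171860).

CHEAPEST FALSIFIER. AEA.md Prop 6.1-style search, one kit job: for the doubled-Kneser candidates
DK(N,k) with N−2k+3 ∈ {4,5} (n ≤ 60 vertices) compute
min over near-balanced B of the split value s(B) by local search / ILP; if some family member has a
balanced cut with s(B) = 0 (as every
system found in 2001 did), DKL-2 is dead and X1 loses its only concrete candidate; independently,
Rem 6.5: estimate the μ-mass of the
spectral rectangle {λ_min(A_B̃-part) certificate} for the uniform measure on random 4-critical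
supports at n = 40.

NUMBERS. Key count of the cover: ≤ 2^{(n/2)log₂ n + c_{Φ,ε} n}, c_{Φ,ε} = O(d_Φ log(1/ε) + p)
(AEA.md 3.5/3.8); threshold in X1: 2^{−(n/2)log₂ n − C n}
for every C; cut defects |L|+|X| ≤ 4(⌈log₂(1/ε)⌉+1) (3.7); fixed-cut rung: s(B₀) = e(K) ≥ n²/256 for
Toft's 4-critical graphs (5.1) versus
the per-cut budget (n/2)log₂ n; every 2001 defect system: min_B s(B) = 0 (6.1). Items at open: 6.

DEFINITION REQUESTS. None at open. Layer-2 (when X1 is split): DefectSystem n / splitValue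
(Summits/PneNP/PneNP/Theorems), Kneser graph + Lovász–Kneser
chromatic number (Literature/Combinatorics) for DKL-1.

Novelty: Searches (2026-08-17): `lit search "existential second-order prefix classes graphs Gottlob Kolaitis
Schwentick"` (6 local: doi:10.1145/972639.972646, arXiv:1412.6396, arXiv:2310.01134 …; 8 remote);
`lit search --hybrid "monadic NP coNP connectivity not definable Fagin Ajtai games"` (8:
book:libkinnd-elements-finite-model-theory p.137/140/187, jukna2012, arora2009 …); `lit galaxy
search "monadic NP|Ajtai-Fagin|binary NP" --star all` (queued-too-long once, retried below); `lean
search nonThreeColClass|threeColClass|ThreeCol --decl` (2026-08-17T18:30Z: ESOPrefixClasses.lean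
p171860; GeneralizedSpectraComplement.lean — `isESODefinable_threeColClass`,
`NP_ne_coNP_of_not_isESODefinable_nonThreeColClass`, named fact
`nonThreeCol_genSpectrum_iff_NP_eq_coNP`; NonThreeColUniversalPrefix.lean —
`nonThreeColClass_not_isPrefixDefinable_forall`, the ∀* rung, all landed today by the sibling typing
seat of sketch PneNP/non3col-eso-cut-rectangles for its route-to-be NonThreeColCutRectangles; no
Theses file yet); ledger negatives --problem PneNP (6 entries, none on ESO / definability /
colourability covers); PneNP Theses grep ThreeCol|Cut|Spectr|Aea (only ThreeColNotInP of
DescentTower — capture-of-P side).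
Nearest prior art found: Ajtai–Fagin games for monadic NP
(book:libkinnd-elements-finite-model-theory Prop 7.20 p.140; Ajtai1983; Fagin1974) — arity 1 only;
GottlobKolaitisSchwentick2004 (doi:10.1145/972639.972646) — classifies ESO PREFIX classes over
graphs by model-checking complexity (E₁  [refs: 10.1145/972639.972646, 1412.6396, 2310.01134, doi:10.1145/972639.972646, book:libkinnd-elements-finite-model-theory, Ajtai1983, Fagin1974, GottlobKolaitisSchwentick2004]

Barriers (technique_class: cut-rectangle fooling-measure, ESO-prefix ladder): - technique_class: cut-rectangle fooling-measure, ESO-prefix ladder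
- Literature.Barriers.PneNP.NaturalProofs: outside — X1/S1 bound the expressive power of ONE ESO
prefix class (model-checking NP-complete but not closed under the FO-reductions that would make it
all of NP or P/poly); no constructive-large property of Boolean functions useful against P/poly is
produced; the step that would need circuit strength (R, T ⇒ NON-3-COL ∉ ESO ⇒ NP ≠ coNP) is the
declared residual, not claimed.
- Literature.Barriers.PneNP.Relativization: outside — no oracle machines occur; definability of a
fixed graph class in a fixed logic does not relativize in the BGS sense; again only R would carry NP
≠ coNP strength.
- Literature.Barriers.PneNP.Algebrization: outside for the same reason as Relativization (no
arithmetised oracle; a counting argument on covers of NON-3-COL_n).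
- Literature.Barriers.PneNP.Locality: not applicable (no hardness magnification / small-fan-in
oracle circuits).
- Literature.Barriers.PneNP.KhrapchenkoLimit: outside — the n² ceiling (Jukna Ex. 6.2, Thm 6.36)
quantifies over convex rectangle measures on Boolean rectangles A × B ⊆ f⁻¹(1) × f⁻¹(0) bounding De
Morgan FORMULA size; X1's cut rectangles 𝓐 ⊗ 𝓑 are sets of GRAPHS (outside-part ∪ inside-part across
a vertex cut) covering a definable class, the bound is on a cover NUMBER 2^{(n/2)log n + O(n)}
versus measure 2^{−(n/2)log n − Cn}, no formula-size measure and no one-bit-neighbour structure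
occurs.
- Literature.Barriers.

History (route lifecycle, newest last):
- 2026-09-03T06:56:26Z · DORMANT — reconciler: no traction for 5 d (last activity item-evidence-added at 2026-08-29T06:08:58Z); parked, not closed — `ledger route dormant route-PneNP-AeaCutRectan (operator:999:1155934)

sub-problem: PneNP · status: dormant · opened planner-type-af19549e9f-0 2026-08-17T18:52:44Z · rev 2 · ledger route-PneNP-AeaCutRectangles
GENERATED by the gate from the ledger (D-0016/17). Provers cite these decls: `theorem foo : Summit.PneNP.PneNP.Theses.AeaCutRectangles.<Decl> := …` in Summits/PneNP/PneNP/Theorems/<Name>.lean.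
-/

namespace Summit.PneNP.PneNP.Theses.AeaCutRectangles

open scoped BigOperators Topology Manifold Classical MeasureTheory ProbabilityTheory Matrix InnerProductSpace ComplexConjugate ContinuousMap
open Filter Set Function TopologicalSpace MeasureTheory

attribute [summit_statement] _root_.PneNP

open Literature.PNP

/-- item stmt-PneNP-19511 · target · rank 0 · open · by planner
why it might fail: ESO(∀∃∀) is strong — HAM, CONN, EVEN (AEA.md §1) and NP-complete problems (E₁aea, GottlobKolaitisSchwentick2004 p.11) live in it; a Skolem function cleverer than 'successor along a certificate' might certify non-3-colourability with one ∀∃∀ block.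
sources: Fagin1974, Ajtai1983, GottlobKolaitisSchwentick2004, archive:2001/pnp/generalized-spectra-complement/work/aea/AEA.md §1 §7
[crux] 𝒩 ∉ ESO(∃*∀∃∀): no existential second-order sentence over the graph vocabulary [2] with
witness relations of any arities, p leading first-order existential quantifiers and first-order
prefix ∀∃∀ over a quantifier-free matrix has model class equal to the class of binary tables whose
symmetrised loop-free graph is not 3-colourable (sketch item X1; `IsPrefixDefinable`,
`nonThreeColClass` landed in Literature/ModelTheory/FiniteModelTheory/ESOPrefixClasses.lean,
p171860). [difficulty: XL] -/
@[route_item "route-PneNP-AeaCutRectangles"]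
def NonThreeColNotInAEA : Prop :=
  ¬ Literature.ModelTheory.FiniteModelTheory.IsPrefixDefinable [2] [Literature.ModelTheory.FiniteModelTheory.FOQuant.all, Literature.ModelTheory.FiniteModelTheory.FOQuant.ex, Literature.ModelTheory.FiniteModelTheory.FOQuant.all] Literature.ModelTheory.FiniteModelTheory.nonThreeColClass

/-- item stmt-PneNP-19727 · crux · rank 2 · open · by planner
why it might fail: AEA.md §6: every defect system found so far has a near-balanced cut with split value 0 (F-5.1's B_X), spectral/SDP certificates (Rem 6.5) suggest μ-heavy rectangles for random-like supports, and the ½·n·log₂n threshold equals the key count with no slack (Rem 3.6a).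
sources: archive:2001/pnp/generalized-spectra-complement/work/aea/AEA.md §4 Rem 4.4 §5 §6, KarchmerWigderson1990, doi:10.1016/0097-3165(78)90022-5, Matousek2002, Toft1995HandbookColouring
[crux] (★★) in near-bisection form (AEA.md Rem 4.4 + Cor 3.8; sketch X1): there is ε ∈ (0,1/4] such
that for every C, for infinitely many n, some probability measure μ on loopless non-3-colourable
edge sets over [n] gives every cut rectangle inside NON-3-COL over every B with (1/2−ε)n ≤ |B| ≤
(1/2+ε)n — 𝓐 a finite family of loopless edge sets each edge meeting [n]∖B, 𝓑 a finite family of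
loopless edge sets inside B, every α ∪ β non-3-colourable — total mass Σ_{(α,β)∈𝓐×𝓑} μ(α ∪ β) ≤
2^{−(n/2)·log₂ n − C·n}. [difficulty: XL] -/
@[route_item "route-PneNP-AeaCutRectangles"]
def FoolingMeasure : Prop :=
  ∃ ε : ℝ, 0 < ε ∧ ε ≤ 1 / 4 ∧ ∀ C : ℕ, ∃ᶠ n in Filter.atTop, ∃ μ : Finset (Sym2 (Fin n)) → ℝ, (∀ S, 0 ≤ μ S) ∧ (∑ S, μ S = 1) ∧ (∀ S, μ S ≠ 0 → (∀ e ∈ S, ¬ e.IsDiag) ∧ ¬ (SimpleGraph.fromEdgeSet (S : Set (Sym2 (Fin n)))).Colorable 3) ∧ ∀ B : Finset (Fin n), (1 / 2 - ε) * (n : ℝ) ≤ B.card → (B.card : ℝ) ≤ (1 / 2 + ε) * n → ∀ 𝓐 𝓑 : Finset (Finset (Sym2 (Fin n))), (∀ α ∈ 𝓐, ∀ e ∈ α, ¬ e.IsDiag ∧ ∃ v ∈ e, v ∉ B) → (∀ β ∈ 𝓑, ∀ e ∈ β, ¬ e.IsDiag ∧ ∀ v ∈ e, v ∈ B) → (∀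 α ∈ 𝓐, ∀ β ∈ 𝓑, ¬ (SimpleGraph.fromEdgeSet ((α ∪ β : Finset (Sym2 (Fin n))) : Set (Sym2 (Fin n)))).Colorable 3) → ∑ q ∈ 𝓐 ×ˢ 𝓑, μ (q.1 ∪ q.2) ≤ (2 : ℝ) ^ (-((n : ℝ) / 2 * Real.logb 2 n) - (C : ℝ) * n)

/-- item stmt-PneNP-19512 · crux · rank 3 · open · by planner
why it might fail: summit-hard in substance — its conclusion yields NP ≠ coNP (Fagin + coNP-completeness of NON-3-COL); nothing is known to propagate a ∀∃∀ non-definability up the ESO prefix hierarchy, and Rem 3.6(a) caps the cut-rectangle method itself at this rung.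
sources: Fagin1974, Fagin1993, AjtaiFagin1990, Immerman1999, book:libkinnd-elements-finite-model-theory p.187, archive:2001/pnp/generalized-spectra-complement/work/aea/AEA.md Rem 3.6
[crux] RESIDUAL (declared T1′ complement, not claimed attackable): if 𝒩 escapes ESO(∃*∀∃∀) then 𝒩 is
not a generalized spectrum about graphs at all — for every list of witness arities no ∃SO sentence
defines 𝒩 (negative answer to Fagin's generalized Asser problem, Fagin1993 p.12); contrapositively
NP = coNP ⇒ 𝒩 ∈ ESO(∃*∀∃∀). [deps: NonThreeColNotAEA] [difficulty: open-problem] -/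
@[route_item "route-PneNP-AeaCutRectangles"]
def AEARungLifts : Prop :=
  (¬ Literature.ModelTheory.FiniteModelTheory.IsPrefixDefinable [2] [Literature.ModelTheory.FiniteModelTheory.FOQuant.all, Literature.ModelTheory.FiniteModelTheory.FOQuant.ex, Literature.ModelTheory.FiniteModelTheory.FOQuant.all] Literature.ModelTheory.FiniteModelTheory.nonThreeColClass) → ¬ Literature.ModelTheory.FiniteModelTheory.IsESODefinable [2] Literature.ModelTheory.FiniteModelTheory.nonThreeColClass

/-- item stmt-PneNP-19728 · support · rank 9 · open · by planner
sources: archive:2001/pnp/generalized-spectra-complement/work/aea/AEA.md Lemma 3.4 Lemma 3.7 Thm 3.5 Cor 3.8 Thm 4.2 (records bc-aea-rectangles bc-aea-cut37), Immerman1999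
[support] the cut-rectangle method (archive-proved, to be formalised): FoolingMeasure →
NonThreeColNotInAEA. Ingredients: Skolem normal form of ∃R̄∃c̄∀x∃y∀zθ; near-bisection cut lemma 3.7
(for f : V → V and ε ≤ 1/4 a B with n/2−εn ≤ |B| ≤ n/2 and |L(B)|+|X(B)| ≤ 4(⌈log₂(1/ε)⌉+1)); hybrid
lemma 3.4 (equal keys ⇒ M₁ ▷_B M₂ ⊨ ψ, by locality of the quantifier-free matrix on {x,f x,z} ∪ C);
rectangle cover 3.5/3.8 with ≤ 2^{(n/2)log₂ n + c_{Φ,ε} n} keys; union bound against μ with C :=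
c_{Φ,ε}+1. Restriction from all binary tables to symmetric loop-free ones is harmless (a defining
sentence restricts). [difficulty: L] -/
@[route_item "route-PneNP-AeaCutRectangles"]
def CutRectangleReduction : Prop :=
  FoolingMeasure → NonThreeColNotInAEA

/-- item stmt-PneNP-19729 · support · rank 9 · open · by planner
sources: archive:2001/pnp/generalized-spectra-complement/work/aea/AEA.md §6 Prop 6.1–Rem 6.5
[support] kill path of X1 (filed so the negative side is visible): every probability measure on
NON-3-COL_n admits, for some near-balanced B, a cut rectangle inside NON-3-COL of mass >
2^{−(n/2)log₂ n − C n}; a proof retires the cut-rectangle method on non-3-colourability (AEA.md §7,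
'negative answer') and is banked as a barrier note. [difficulty: XL] -/
@[route_item "route-PneNP-AeaCutRectangles"]
def NoFoolingMeasure : Prop :=
  ¬ FoolingMeasure

/-- item stmt-PneNP-19730 · assembly · rank 1 · open · by planner
sources: Fagin1974, Fagin1993, Immerman1999
[assembly] FoolingMeasure → CutRectangleReduction → AEARungLifts → PneNP (the deciding theorem
`closes` proves exactly this). -/
@[route_item "route-PneNP-AeaCutRectangles"]
def Assembly : Prop :=
  FoolingMeasure → CutRectangleReduction → AEARungLifts → PneNP

/-! D-0027 §2.1 — DECIDING THEOREM (planner-authored via `route open/edit --closes-file`; by planner-type-af19549e9f-0 2026-08-17T18:52:44Z):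
its hypotheses are this route's items and its conclusion the sub-problem Statement (glue_lint), and it elaborates with this file. -/

@[closes "route-PneNP-AeaCutRectangles"] theorem closes (h₁ : FoolingMeasure) (hS1 : CutRectangleReduction) (hR : AEARungLifts) : PneNP := by
  -- P = NP would give NP = coNP; but the cruxes give `𝒩 ∉ ∃SO`, hence NP ≠ coNP (Fagin 1993, Thm. 5.3 with 5.2).
  refine Literature.Computability.Complexity.pneNP_shape_of_P_ne_NP ?_
  intro hPNP
  refine Literature.ModelTheory.FiniteModelTheory.NP_ne_coNP_of_not_isESODefinable_nonThreeColClass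
    (hR (hS1 h₁)) ?_
  show Literature.Computability.Complexity.Nondeterministic.NP
      = Literature.Computability.Complexity.co Literature.Computability.Complexity.Nondeterministic.NP
  rw [← hPNP]
  exact Literature.Computability.Complexity.co_P_holds.symm

end Summit.PneNP.PneNP.Theses.AeaCutRectangles
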